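import Summits.BirchSwinnertonDyer.BirchSwinnertonDyer.Theorems.SignedLowerHalvesSmallImageLowerHalfBothSignsRttCharRoadKummerStability
import Literature.NumberTheory.EllipticCurves.NeronOggShafarevichLocal
import HarnessLib

/-!
# Route `SignedLowerHalves`, crux L `SmallImageLowerHalfBothSigns` (stmt-BirchSwinnertonDyer-23599), line `rtt_w3` v10′ — row B5-pts of COUNT_π:
# the endomorphism `u` of `W[p^∞]` INDUCED by an endomorphism of `E₁ ⊇ E(K̄_E)[p^∞]` (the hypothesis `hu` of `…RttCharRoadKummerStability`)

Hand `bsd-inputs-honda-p1` g19 (LEAD `cruxlead-stmt-BirchSwinnertonDyer-23599` g6, D3-c owner `bsd-line-slh-p3-w3` g17); helper `--supports 23599`;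
THEOREMS ONLY (no definition, no named fact, no instance, no `sorry`).  BSD / crux L / COUNT_π / D3-c are NOT proved here.

`…RttCharRoadKummerStability.exists_kummerDatum_translate_signedLocalPointsOfEmb` (p765177) takes an endomorphism `u` of the GLOBAL `p`-primary
torsion `W[p^∞] = W.geomPrimaryTorsion p ⊆ E(K̄)` together with `hu : ι ∘ u = act ∘ ι`.  Here ★ `exists_torsionHom_of_act`: for ANY additive
`act : E₁ →+ E₁` on a subgroup `E₁ ≤ E(K̄_E)` containing all `p`-power torsion, such a `u` EXISTS (and is determined by `hu`): `act` preserves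
`p`-power torsion, all torsion of `E(K̄_E)` comes from `E(K̄)` (`exists_pointsMapOfEmb_eq_of_nsmul_eq_zero`, Silverman III.6.4 (b)), and `ι_*` is
injective.  With the formal `𝒪_{K_v}`-module `act b` of `…RttCharRoadFormalModuleLocalPoints.exists_formalModule_localPoints_of_model` this is the
family `u_b = ι⁻¹ ∘ [b] ∘ ι` of the B5-pts plan (HELPER-TABLE v10 addendum 4).

References: [SilvermanAEC2009] III.6.4 (b), VII.3; [Kobayashi2003] Def. 1.1, §8; [KimPark2017] §2.2 Prop. 2.5.
-/

set_option autoImplicit false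
set_option linter.dupNamespace false -- D-0017: single-problem summit, the namespace repeats the problem name by design
noncomputable section

open scoped Classical

universe u

namespace Summit.BirchSwinnertonDyer.BirchSwinnertonDyer.Theorems.SmallImageCharSignedSelmer

open Literature.NumberTheory.EllipticCurves Literature.NumberTheory.GaloisRepresentations Field

variable {K : Type u} [Field K] [CharZero K] {p : ℕ} [hp : Fact p.Prime] {E : Type u} [Field E] [Algebra K E]
  {W : WeierstrassCurve K} [W.IsElliptic] {ι : AlgebraicClosure K →ₐ[K] AlgebraicClosure E}
  {E₁ : AddSubgroup (localPoints W E)}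

omit [CharZero K] hp [W.IsElliptic] in
/-- The image `act(ι x)` of a `p`-primary torsion point is again killed by a power of `p` (additivity of `act`). [folklore] -/
theorem exists_pow_smul_coe_act_eq_zero (act : E₁ →+ E₁) (x : W.geomPrimaryTorsion p)
    (hx : pointsMapOfEmb W ι (x : W.geomPoints) ∈ E₁) :
    ∃ n : ℕ, p ^ n • (act ⟨_, hx⟩ : localPoints W E) = 0 := by
  obtain ⟨n, hn⟩ := x.2
  refine ⟨n, ?_⟩
  rw [← AddSubgroup.coe_nsmul, ← map_nsmul]
  have h0 : p ^ n • (⟨pointsMapOfEmb W ι (x : W.geomPoints), hx⟩ : E₁) = 0 := by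
    apply Subtype.ext
    rw [AddSubgroup.coe_nsmul, AddSubgroup.coe_zero]
    change p ^ n • pointsMapOfEmb W ι (x : W.geomPoints) = 0
    rw [← map_nsmul, hn, map_zero]
  rw [h0, map_zero, AddSubgroup.coe_zero]

/-- ★ **The endomorphism of `W[p^∞]` induced by an endomorphism of `E₁ ⊇ E(K̄_E)[p^∞]`**: if every `p`-power torsion point of `E(K̄_E)` lies in
`E₁ ≤ E(K̄_E)` then for every additive `act : E₁ →+ E₁` there is an additive `u : W[p^∞] →+ W[p^∞]` with `ι(u x) = act(ι x)` — the hypothesis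
`hu` of `exists_kummerDatum_translate_signedLocalPointsOfEmb`.  (`act(ι x)` is `p`-power torsion, hence `ι y` for a unique torsion `y ∈ E(K̄)`,
Silverman III.6.4 (b).) [cite: SilvermanAEC2009, III.6.4 (b)] [cite: Kobayashi2003, §8] -/
theorem exists_torsionHom_of_act (act : E₁ →+ E₁) (htors : ∀ (n : ℕ) (T : localPoints W E), p ^ n • T = 0 → T ∈ E₁) :
    ∃ u : W.geomPrimaryTorsion p →+ W.geomPrimaryTorsion p,
      ∀ (x : W.geomPrimaryTorsion p) (hx : pointsMapOfEmb W ι (x : W.geomPoints) ∈ E₁),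
        pointsMapOfEmb W ι (u x : W.geomPoints) = (act ⟨_, hx⟩ : localPoints W E) := by
  -- every `p`-primary torsion point maps into `E₁`
  have hmem : ∀ x : W.geomPrimaryTorsion p, pointsMapOfEmb W ι (x : W.geomPoints) ∈ E₁ := by
    intro x
    obtain ⟨n, hn⟩ := x.2
    refine htors n _ ?_
    rw [← map_nsmul, hn, map_zero]
  -- the preimage of `act(ι x)` in `W[p^∞]`
  have hpre : ∀ x : W.geomPrimaryTorsion p, ∃ y : W.geomPrimaryTorsion p,
      pointsMapOfEmb W ι (y : W.geomPoints) = (act ⟨_, hmem x⟩ : localPoints W E) := by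
    intro x
    obtain ⟨n, hn⟩ := exists_pow_smul_coe_act_eq_zero act x (hmem x)
    obtain ⟨P, hP, hPe⟩ := exists_pointsMapOfEmb_eq_of_nsmul_eq_zero W ι (pow_ne_zero n hp.out.ne_zero) hn
    exact ⟨⟨P, n, hP⟩, hPe⟩
  choose f hf using hpre
  have hinj := pointsMapOfEmb_injective W ι
  refine ⟨{ toFun := f
            map_zero' := ?_
            map_add' := fun x y => ?_ }, fun x hx => ?_⟩
  · have h0 : (⟨pointsMapOfEmb W ι ((0 : W.geomPrimaryTorsion p) : W.geomPoints), hmem 0⟩ : E₁) = 0 :=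
      Subtype.ext (by
        change pointsMapOfEmb W ι ((0 : W.geomPrimaryTorsion p) : W.geomPoints) = ((0 : E₁) : localPoints W E)
        rw [AddSubgroup.coe_zero, AddSubgroup.coe_zero, map_zero])
    have h := hf 0
    rw [h0, map_zero, AddSubgroup.coe_zero] at h
    apply Subtype.ext
    apply hinj
    rw [h, AddSubgroup.coe_zero, map_zero]
  · have hxy : (⟨pointsMapOfEmb W ι ((x + y : W.geomPrimaryTorsion p) : W.geomPoints), hmem (x + y)⟩ : E₁) =
        ⟨_, hmem x⟩ + ⟨_, hmem y⟩ :=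
      Subtype.ext (by
        change pointsMapOfEmb W ι ((x + y : W.geomPrimaryTorsion p) : W.geomPoints) =
          pointsMapOfEmb W ι (x : W.geomPoints) + pointsMapOfEmb W ι (y : W.geomPoints)
        rw [AddSubgroup.coe_add, map_add])
    have h := hf (x + y)
    rw [hxy, map_add, AddSubgroup.coe_add, ← hf x, ← hf y, ← map_add, ← AddSubgroup.coe_add] at h
    exact Subtype.ext (hinj h)
  · exact hf x

end Summit.BirchSwinnertonDyer.BirchSwinnertonDyer.Theorems.SmallImageCharSignedSelmer

end
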